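import Summits.AtomisticToContinuum.BoseEinsteinCondensation.Theorems.BECThomsonPrincipleGDTransferSeededSpectralDefs
import Summits.AtomisticToContinuum.BoseEinsteinCondensation.Theorems.BECThomsonPrincipleGDTransferSeededCompactDefs

/-!
# Route `BECThomsonPrinciple`, crux `GDTransfer` (stmt-AtomisticToContinuum-9482), line `seeded-continuity`:
# eighth Defs file — the spectral seed for the INTEGRABLE class (lead c4, wave 3: twin round)

`Defs` file (D-0016) continuing `…SeededSpectralDefs` (p164024).  The spectral-seed programme (a balanced cat forces a small Ky Fan gap,
so `NoBalancedCatFor v ⟸ KyFanGapFloorFor v`) was typed and proved for FINITE CONTINUOUS profiles, where the `n̂₀`-grading of the energy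
form (`InteractionLocality`, bilinearity of the interaction form, Cauchy–Schwarz for continuous weights) was already in tree.  Skeleton v8's
soft class is larger: profiles finite on `[0, ∞)` with INTEGRABLE lift (`IsIntegrableProfile`).  This file types the twin statements for that
class — the pair weights `X ↦ v^per(x_p − x_q)` are then in `L¹(cell^N)` instead of `C(cell^N)`, and the landed `_int` form calculus of
`…SeededPlainFormsInt` / `…PlainInteractionInt` replaces the continuous one — so that the spectral door and the v8 soft class coincide:
`InteractionLocalityInt`, `SmoothSplittingInt`, `PinchingBoundInt`; registered sub-goals `interactionLocalityInt`, `smoothSplittingInt`,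
`pinchingBoundInt`, `seedForInt_of_kyFanGapFloor`; plus the free-gas sanity `kyFanGapFloorFor_zero` (the gap floor is not vacuous: at `v = 0`
it is the torus Poincaré inequality `kyFanTwo(0, N, L) ≥ 4π²/L²`).  `CatKyFan` and `SmoothBlockAlgebra` need no twin (they see `v` only
through `Measurable v`).  Nothing open is asserted.

References: ReedSimonIV1978 Thm XIII.1–2, §XIII.12; LSSY2005 §1.2, Ch. 5; Fournais2020 Assumption 1.1.
-/

noncomputable section

open MeasureTheory Filter
open scoped ENNReal NNReal ComplexConjugate

namespace Summit.AtomisticToContinuum.BoseEinsteinCondensation.Cruxes.GDTransfer.Seeded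

open Literature.MathematicalPhysics.QuantumManyBody.BoseGas
open Summit.AtomisticToContinuum.BoseEinsteinCondensation.Theses.BECThomsonPrinciple
open Summit.AtomisticToContinuum.BoseEinsteinCondensation.Theorems.GaussianDominationCan.Negative (modeProj)
open Summit.AtomisticToContinuum.BoseEinsteinCondensation.Cruxes.GDTransfer.DysonDressedWitness (IsDirection mass eform)

/-! ## §1 Twin statements for the integrable class -/

/-- THE INTERACTION FORM HAS `Q_S`-BANDWIDTH TWO, integrable class (twin of `InteractionLocality`): for a profile finite on `[0, ∞)` with
integrable lift, `𝓥(Q_S f, Q_T f) = 0` whenever `T ∖ S` has at least three elements (same mechanism: a slot of `T ∖ S` off the pair is flat for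
every pair weight and its cell average is self-adjoint; integrable weights through the `_int` form calculus). -/
def InteractionLocalityInt : Prop :=
  ∀ v : ℝ → ℝ≥0∞, IsRepulsiveFiniteRange v → IsIntegrableProfile v →
    ∀ (m : ℕ) (L : ℝ), 0 < L → ∀ (S T : Finset (Fin (m + 1))), 3 ≤ (T \ S).card →
      ∀ f : Config (m + 1) → ℂ, Continuous f → vform v m L (modeProj (m + 1) L S f) (modeProj (m + 1) L T f) = 0

/-- THE SMOOTH SPLITTING INEQUALITY, integrable class (twin of `SmoothSplitting`, same constant). -/
def SmoothSplittingInt : Prop :=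
  ∀ v : ℝ → ℝ≥0∞, IsRepulsiveFiniteRange v → IsIntegrableProfile v →
    ∀ (m : ℕ) (L : ℝ), 0 < L → ∀ θ β : ℝ, 0 < θ → 0 < β → θ + β < 1 → ∀ Ψ : PeriodicTrialState (m + 1) L,
      eform v L (smoothBlock m L (cutLo θ β) Ψ.ψ) + eform v L (smoothBlock m L (cutHi θ β) Ψ.ψ) ≤
        periodicEnergy v Ψ +
          ENNReal.ofReal (8 * Real.pi ^ 2 / ((1 - β - θ) ^ 2 * (((m : ℝ) + 1) ^ 2))) * sectorDiagV v m L Ψ.ψ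

/-- THE PINCHING BOUND, integrable class (twin of `PinchingBound`, same constants). -/
def PinchingBoundInt : Prop :=
  ∀ v : ℝ → ℝ≥0∞, IsRepulsiveFiniteRange v → IsIntegrableProfile v →
    ∀ (m : ℕ) (L : ℝ), 0 < L → ∀ Ψ : PeriodicTrialState (m + 1) L,
      sectorDiagV v m L Ψ.ψ ≤
        16 * (∫⁻ X in cellN (m + 1) L, periodicInteraction v L X * (‖Ψ.ψ X‖₊ : ℝ≥0∞) ^ 2) +
          ENNReal.ofReal (64 * lift1 v * ((m : ℝ) + 1) ^ 2 / L ^ 3)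

/-! ## §2 Sanity (sorry-free) -/

/-- Finite continuous finite-range profiles are integrable profiles (bounded on `ℝ³` by continuity on the compact support ball), so the
integrable twins specialise to the finite continuous statements' hypotheses. -/
theorem isIntegrableProfile_of_isFiniteContinuous : ∀ v : ℝ → ℝ≥0∞, IsRepulsiveFiniteRange v → IsFiniteContinuous v → IsIntegrableProfile v :=
  fun _ hv hfc => ⟨fun r _ => hfc.1 r, lintegral_ne_top_of_isFiniteContinuous hv hfc⟩


end Summit.AtomisticToContinuum.BoseEinsteinCondensation.Cruxes.GDTransfer.Seeded

end
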